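import Summits.ResolutionOfSingularities.ResolutionOfSingularities.Theorems.RadicialJungCleanModelsGradedAssembly
import HarnessLib

/-!
# `RadicialJung.CleanModels` from the registered dim-3 inputs and the graded inputs for `d ≥ 4`, through ONE all-dimension node

Route `RadicialJung`, crux `CleanModels` (stmt-ResolutionOfSingularities-15917), registered skeleton `Cruxes/CleanModels/Lines/Sketch.lean`
rev 35 (sha16 de44649d8f729c3b).  Explicit-unit seat `decomp-res-hand-2` g4.  Companion of `RadicialJungCleanModelsGradedAssembly.lean`
(✓ `GradedAssembly.cleanModels_of_cleanLUZeroDim_of_cleanTwoModelPatching_allDim`: the crux from `CleanLUZeroDim_d ∧ hZ_d`, `d ≥ 3`, and the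
`d = 3` discharges of the graded inputs from the registered dim-3 stubs).  OURS; structural bookkeeping, counted 0; nothing here proves
resolution of singularities in characteristic `p`.

* `cleanModels_of_dimThreeInputs_of_allDimGEFour` — the crux from the registered dim-3 inputs (Thm. 1.1 accounting of
  ✓ `RadicialJungCleanModelsOfInputsThm11`: `CP2019.CossartPiltant2019Thm11` · F-112 · stub 4 · the rev-35 research stubs 5 and 6, VERBATIM as
  hypotheses) and the TWO graded inputs `CleanLUZeroDim_d`, `hZ_d` for `d ≥ 4`, uniformly through the one node;
* `cleanModels_of_dimThreeInputs_of_localMonomializationGEFour` — the same with `CleanLUZeroDim_d` (`d ≥ 4`) split as `hMono_d ∧ hND_d`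
  (✓ `cleanLUZeroDim_dim_of_localMonomialization`): exactly the inputs of stub 7's reduction of record ✓ `cleanModelsDimGEFour_of_localMonomialization`,
  so this is the uniform form of ✓ `OfInputsThm11.cleanModels_of_inputs` with `hGE4` discharged by hand-2 g3's graded reduction.
-/

noncomputable section

set_option linter.dupNamespace false -- mandated namespace of this single-conjunct summit

open CategoryTheory AlgebraicGeometry IsLocalRing
open Literature.AlgebraicGeometry.Resolution Literature.AlgebraicGeometry.Motives
open Literature.AlgebraicGeometry.CossartPiltant200819

namespace Summit.ResolutionOfSingularities.ResolutionOfSingularities.Theorems.RadicialJung.CleanModels.GradedAssembly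

section Inputs

/-! The registered dim-3 stubs of Sketch rev 35, VERBATIM, as hypotheses (as in the companion file). -/
variable
  (h11 : CP2019.CossartPiltant2019Thm11.{0})
  (h112 : Cossart1987Thm)
  (hBS2 :
    ∀ (S : Type) [CommRing S] [IsRegularLocalRing S],
      IsExcellentRing S → ringKrullDim S = 3 → CharP S 2 →
      ∀ (K : Type) [Field K] [Algebra S K] [IsFractionRing S K] (f : S),
      (∀ c : K, c ^ 2 ≠ algebraMap S K f) →
      ∀ (O : ValuationSubring K), (algebraMap S K).range ≤ O.toSubring →
      (∀ s ∈ IsLocalRing.maximalIdeal S, O.valuation (algebraMap S K s) < 1) →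
      ∃ (n : ℕ) (B : ℕ → Subring K) (g : ℕ → K),
      B 0 = locAtCentre (algebraMap S K).range O ∧ g 0 = algebraMap S K f ∧
      (∀ i ≤ n, B i ≤ O.toSubring ∧ IsRegularLocalRing (B i) ∧ g i ∈ B i) ∧
      (∀ i < n, ∃ P : Ideal (B i), IsRegularLocalRing ((B i) ⧸ P) ∧
        IsLocalBlowupAlong O (B i) P (B (i + 1)) ∧
        ∃ c d : K, c ≠ 0 ∧ g (i + 1) = c ^ 2 * g i + d ^ 2) ∧
      ∀ (hg : g n ∈ B n) (_hBn : IsRegularLocalRing (B n)) (c : B n),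
        (⟨g n, hg⟩ : B n) - c ^ 2 ∉ IsLocalRing.maximalIdeal (B n) ^ 2)
  (hB :
    ∀ (p : ℕ), p.Prime → p ≠ 2 →
    ∀ (k : Type) [Field k] [CharP k p] (K : Type) [Field K] [Algebra k K]
    (O : ValuationSubring K) (A : Subalgebra k K), A.toSubring ≤ O.toSubring → A.FG → IsFractionRing A K →
    ringKrullDim A ≤ 3 → IsRegularLocalRing (locAtCentre A.toSubring O) →
    ringKrullDim (locAtCentre A.toSubring O) = 3 →
    (∀ (T : Subring K) (hT : T ≤ O.toSubring), A.toSubring ≤ T → (subringCentre T O hT).IsMaximal) →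
    ∀ g₀ : K, (∀ c : K, c ^ p ≠ g₀) →
    (∀ f₀ : K, ∃ f₁ : K, O.valuation (g₀ - f₁ ^ p) < O.valuation (g₀ - f₀ ^ p)) →
    (∀ hk : ∀ c : k, algebraMap k K c ∈ O, transcendenceDefect k O hk ≠ 0) →
    ¬ (∃ π : K, π ≠ 0 ∧ (∀ x : K, O.valuation x < 1 → O.valuation x ≤ O.valuation π) ∧
      (∀ x : K, x ≠ 0 → ∃ n : ℕ, O.valuation π ^ n ≤ O.valuation x)) →
    ¬ (∃ (O₁ : ValuationSubring K), O ≤ O₁ ∧ O₁ ≠ ⊤ ∧ ∃ y : Fin 2 → K, (∀ i, y i ∈ O) ∧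
      ∀ P : MvPolynomial (Fin 2) k, P ≠ 0 → O₁.valuation (MvPolynomial.aeval y P) = 1) →
    ¬ ((∃ x y : K, x ≠ 0 ∧ y ≠ 0 ∧ ∀ a b : ℕ, a < p → b < p → (a ≠ 0 ∨ b ≠ 0) →
        ∀ z : K, z ≠ 0 → O.valuation (x ^ a * y ^ b) ≠ O.valuation (z ^ p)) ∧
      ∃ r : ℕ, Module.finrank (Subfield.closure (Set.range (fun x : k => x ^ p))) k = p ^ r ∧
        Module.finrank (Subfield.closure (Set.range (fun x : IsLocalRing.ResidueField O => x ^ p))) (IsLocalRing.ResidueField O) = p ^ r) →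
    ¬ ((∃ x y : K, x ≠ 0 ∧ y ≠ 0 ∧ ∀ a b : ℕ, a < p → b < p → (a ≠ 0 ∨ b ≠ 0) →
        ∀ z : K, z ≠ 0 → O.valuation (x ^ a * y ^ b) ≠ O.valuation (z ^ p)) ∧
      ∃ k' : IntermediateField k K, FiniteDimensional k k' ∧
        (∃ (n : ℕ) (s : Fin n → K), AlgebraicIndependent k' s ∧ Algebra.IsSeparable (IntermediateField.adjoin k' (Set.range s)) K) ∧
        ∃ _ : Algebra k' (IsLocalRing.ResidueField O),
          (∀ (c : k') (h : algebraMap k' K c ∈ O),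
            algebraMap k' (IsLocalRing.ResidueField O) c = IsLocalRing.residue O ⟨algebraMap k' K c, h⟩) ∧
          Algebra.IsSeparable k' (IsLocalRing.ResidueField O)) →
    ¬ IsAlgClosed k →
    ¬ (∃ O₁ : ValuationSubring K, O ≤ O₁ ∧ O₁ ≠ O ∧ O₁ ≠ ⊤) →
    ¬ (∃ (A' : Subalgebra k K) (_ : A'.toSubring ≤ O.toSubring) (_ : A ≤ A') (_ : A'.FG)
        (_ : IsRegularLocalRing (locAtCentre A'.toSubring O)) (c : Fin p → K) (_ : ∃ j : Fin p, (j : ℕ) ≠ 0 ∧ c j ≠ 0)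
        (h : ↥(locAtCentre A'.toSubring O)) (_ : (∑ j : Fin p, c j ^ p * g₀ ^ (j : ℕ)) = (h : K))
        (d : ℕ) (_ : 0 < d) (_ : (IsLocalRing.maximalIdeal ↥(locAtCentre A'.toSubring O)).spanFinrank = d)
        (t : Fin d → ↥(locAtCentre A'.toSubring O)) (_ : Ideal.span (Set.range t) = IsLocalRing.maximalIdeal ↥(locAtCentre A'.toSubring O))
        (F : MvPolynomial (Fin d) ↥(locAtCentre A'.toSubring O)) (e N : ℕ) (_ : F.IsHomogeneous e) (_ : ¬ p ∣ e) (_ : e ≤ N + 1),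
        h - MvPolynomial.aeval t F ∈ IsLocalRing.maximalIdeal ↥(locAtCentre A'.toSubring O) ^ (e + 1) ∧
        ∀ i, ∃ b : Fin d → ↥(locAtCentre A'.toSubring O),
          (∀ l, b l ∈ IsLocalRing.maximalIdeal ↥(locAtCentre A'.toSubring O) ^ (N + 1 - e)) ∧
          t i ^ N - ∑ l, b l * MvPolynomial.aeval t (MvPolynomial.pderiv l F) ∈
            IsLocalRing.maximalIdeal ↥(locAtCentre A'.toSubring O) ^ (N + 1)) →
    ∃ (A' : Subalgebra k K), A'.toSubring ≤ O.toSubring ∧ A ≤ A' ∧ A'.FG ∧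
    ∃ (_ : IsRegularLocalRing (locAtCentre A'.toSubring O)) (c : Fin p → K), (∃ j : Fin p, (j : ℕ) ≠ 0 ∧ c j ≠ 0) ∧
    ((∃ (d m : ℕ) (hmd : m ≤ d) (t : Fin d → ↥(locAtCentre A'.toSubring O)) (a : Fin m → ℕ) (u : ↥(locAtCentre A'.toSubring O)), IsUnit u ∧
    Ideal.span (Set.range t) = IsLocalRing.maximalIdeal ↥(locAtCentre A'.toSubring O) ∧
    ringKrullDim ↥(locAtCentre A'.toSubring O) = (d : WithBot ℕ∞) ∧ 0 < m ∧ (∀ i, ¬ p ∣ a i) ∧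
    (∑ j : Fin p, c j ^ p * g₀ ^ (j : ℕ)) = (u : K) * ∏ i : Fin m, ((t (Fin.castLE hmd i) : ↥(locAtCentre A'.toSubring O)) : K) ^ (a i)) ∨
    (∃ u : ↥(locAtCentre A'.toSubring O), IsUnit u ∧ (∑ j : Fin p, c j ^ p * g₀ ^ (j : ℕ)) = (u : K) ∧
    ∀ c' : ↥(locAtCentre A'.toSubring O), u - c' ^ p ∉ IsLocalRing.maximalIdeal ↥(locAtCentre A'.toSubring O)) ∨
    (∃ s c' : ↥(locAtCentre A'.toSubring O), (∑ j : Fin p, c j ^ p * g₀ ^ (j : ℕ)) = (s : K) ∧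
    s - c' ^ p ∈ IsLocalRing.maximalIdeal ↥(locAtCentre A'.toSubring O) ∧
    s - c' ^ p ∉ IsLocalRing.maximalIdeal ↥(locAtCentre A'.toSubring O) ^ 2)))
  (h44c :
    ∀ (p : ℕ), p.Prime → ∀ (S : Scheme.{0}) [IsIntegral S] [IsNoetherian S],
      CharP S.functionField p → Scheme.IsRegular S → Scheme.IsExcellent S → topologicalKrullDim S = 3 →
      ∀ G₀ : S.functionField, (∀ s : S, CleanRegAt p (algebraMap (S.presheaf.stalk s) S.functionField) G₀) →
      ∀ I : S.IdealSheafData, I ≠ ⊥ →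
      ∀ (X : Scheme.{0}) (ρ : X ⟶ S) [IsIntegral X] [IsNoetherian X] [IsDominant ρ],
        IsCleanRegularCentreBlowupSeq p ρ I G₀ →
        (∀ x : X, CleanRegAt p (algebraMap (X.presheaf.stalk x) X.functionField) (RatFn.functionFieldMap ρ G₀)) →
        ∀ (J : X.IdealSheafData) (μ : ℕ), 1 ≤ μ →
          (∀ x ∈ J.support, 1 < Order.coheight x) → (∀ x, idealOrder J x ≤ μ) → (∃ x, idealOrder J x = μ) →
          ∃ (X' : Scheme.{0}) (π : X' ⟶ X) (_ : IsIntegral X') (_ : IsDominant π) (J' : X'.IdealSheafData),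
            IsCleanPermissibleSeq p π J μ J' (RatFn.functionFieldMap ρ G₀) ∧ ∀ x, idealOrder J' x < μ)

/-! ## §3 The crux from the registered dim-3 inputs and the graded inputs for `d ≥ 4`, through the one node -/

include h11 h112 hBS2 hB h44c in
/-- **`CleanModels` from the registered dim-3 inputs (Thm. 1.1 accounting) and the two graded inputs for `d ≥ 4`**, uniformly through
`cleanModels_of_cleanLUZeroDim_of_cleanTwoModelPatching_allDim`: at `d = 3` the graded inputs are `cleanLUZeroDim_three_of_inputs` and
`cleanTwoModelPatching_three_of_cleanProp44`; for `d ≥ 4` they are the hypotheses `hLU4` / `hZ4` (the dim-`d` forms of the node `cleanLU3_of_stubs`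
and of stub 4b — both OPEN).  Same input ledger as ✓ `OfInputsThm11.cleanModels_of_inputs`, with its frontier hypothesis `hGE4` replaced by the
graded pair. [cite: CossartPiltant2019, Thm. 1.1] [cite: Piltant2013, Prop. 5.1 and Cor. 5.7] -/
theorem cleanModels_of_dimThreeInputs_of_allDimGEFour
    (hLU4 : ∀ d : ℕ, 4 ≤ d → ∀ (p : ℕ), p.Prime →
    ∀ (k : Type) [Field k] [CharP k p] (K : Type) [Field K] [Algebra k K]
    (O : ValuationSubring K) (A : Subalgebra k K), A.toSubring ≤ O.toSubring → A.FG → IsFractionRing A K →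
    ringKrullDim A ≤ (d : WithBot ℕ∞) → IsRegularLocalRing (locAtCentre A.toSubring O) →
    ringKrullDim (locAtCentre A.toSubring O) = (d : WithBot ℕ∞) →
    (∀ (T : Subring K) (hT : T ≤ O.toSubring), A.toSubring ≤ T → (subringCentre T O hT).IsMaximal) →
    ∀ g₀ : K, (∀ c : K, c ^ p ≠ g₀) →
    ∃ (A' : Subalgebra k K), A'.toSubring ≤ O.toSubring ∧ A ≤ A' ∧ A'.FG ∧
    ∃ (_ : IsRegularLocalRing (locAtCentre A'.toSubring O)) (c : Fin p → K), (∃ j : Fin p, (j : ℕ) ≠ 0 ∧ c j ≠ 0) ∧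
    ((∃ (d m : ℕ) (hmd : m ≤ d) (t : Fin d → ↥(locAtCentre A'.toSubring O)) (a : Fin m → ℕ) (u : ↥(locAtCentre A'.toSubring O)), IsUnit u ∧
    Ideal.span (Set.range t) = IsLocalRing.maximalIdeal ↥(locAtCentre A'.toSubring O) ∧
    ringKrullDim ↥(locAtCentre A'.toSubring O) = (d : WithBot ℕ∞) ∧ 0 < m ∧ (∀ i, ¬ p ∣ a i) ∧
    (∑ j : Fin p, c j ^ p * g₀ ^ (j : ℕ)) = (u : K) * ∏ i : Fin m, ((t (Fin.castLE hmd i) : ↥(locAtCentre A'.toSubring O)) : K) ^ (a i)) ∨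
    (∃ u : ↥(locAtCentre A'.toSubring O), IsUnit u ∧ (∑ j : Fin p, c j ^ p * g₀ ^ (j : ℕ)) = (u : K) ∧
    ∀ c' : ↥(locAtCentre A'.toSubring O), u - c' ^ p ∉ IsLocalRing.maximalIdeal ↥(locAtCentre A'.toSubring O)) ∨
    (∃ s c' : ↥(locAtCentre A'.toSubring O), (∑ j : Fin p, c j ^ p * g₀ ^ (j : ℕ)) = (s : K) ∧
    s - c' ^ p ∈ IsLocalRing.maximalIdeal ↥(locAtCentre A'.toSubring O) ∧
    s - c' ^ p ∉ IsLocalRing.maximalIdeal ↥(locAtCentre A'.toSubring O) ^ 2)))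
    (hZ4 : ∀ d : ℕ, 4 ≤ d → ∀ (p : ℕ), p.Prime → ∀ (k K : Type) [Field k] [CharP k p] [Field K] [Algebra k K] [Algebra.EssFiniteType k K],
    Algebra.trdeg k K = d → ∀ (g₀ : K) (M₁ M₂ : ProjModel k K) (U₁ : M₁.X.Opens) (U₂ : M₂.X.Opens),
    (∀ x ∈ U₁, ModelCleanRegAt p g₀ M₁ x) → (∀ x ∈ U₂, ModelCleanRegAt p g₀ M₂ x) →
    ∃ (N : ProjModel k K) (φ₁ : N.Hom M₁) (φ₂ : N.Hom M₂),
    (∀ y : N.X, φ₁.f y ∈ U₁ → ModelCleanRegAt p g₀ N y) ∧ (∀ y : N.X, φ₂.f y ∈ U₂ → ModelCleanRegAt p g₀ N y)) :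
    Summit.ResolutionOfSingularities.ResolutionOfSingularities.Theses.RadicialJung.CleanModels := by
  refine cleanModels_of_cleanLUZeroDim_of_cleanTwoModelPatching_allDim (fun d hd => ?_) (fun d hd => ?_)
  · by_cases h3 : d = 3
    · subst h3
      exact cleanLUZeroDim_three_of_inputs h11 h112 hBS2 hB
    · exact hLU4 d (by omega)
  · by_cases h3 : d = 3
    · subst h3
      exact cleanTwoModelPatching_three_of_cleanProp44 h44c
    · exact hZ4 d (by omega)

include h11 h112 hBS2 hB h44c in
/-- **`CleanModels` from the registered dim-3 inputs and THREE graded inputs for `d ≥ 4`** (`hMono_d`, `hND_d`, `hZ_d`, `d ≥ 4` — exactly the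
inputs of stub 7's reduction of record ✓ `cleanModelsDimGEFour_of_localMonomialization`), uniformly through the one node.
[cite: KnafKuhlmann2005, Thm. 1.1] [cite: CutkoskyMourtada2019, Def. 1.2] [cite: Piltant2013, Prop. 5.1] -/
theorem cleanModels_of_dimThreeInputs_of_localMonomializationGEFour
    (hMono4 : ∀ d : ℕ, 4 ≤ d → ∀ (k : Type) [Field k] (K : Type) [Field K] [Algebra k K]
    (O : ValuationSubring K) (A : Subalgebra k K), A.toSubring ≤ O.toSubring → A.FG → IsFractionRing A K →
    ringKrullDim A ≤ (d : WithBot ℕ∞) → IsRegularLocalRing (locAtCentre A.toSubring O) →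
    ringKrullDim (locAtCentre A.toSubring O) = (d : WithBot ℕ∞) →
    (∀ (T : Subring K) (hT : T ≤ O.toSubring), A.toSubring ≤ T → (subringCentre T O hT).IsMaximal) →
    ∀ Z : Finset K, (∀ z ∈ Z, z ∈ A) →
    ∃ (A' : Subalgebra k K), A'.toSubring ≤ O.toSubring ∧ A ≤ A' ∧ A'.FG ∧
    ∃ (_ : IsRegularLocalRing (locAtCentre A'.toSubring O)) (e : ℕ) (a : Fin e → ↥(locAtCentre A'.toSubring O)),
      Ideal.span (Set.range a) = IsLocalRing.maximalIdeal ↥(locAtCentre A'.toSubring O) ∧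
      ringKrullDim ↥(locAtCentre A'.toSubring O) = (e : WithBot ℕ∞) ∧
      ∀ z ∈ Z, z ≠ 0 → ∃ (v : ↥(locAtCentre A'.toSubring O)) (μ : Fin e → ℕ), IsUnit v ∧
        z = (v : K) * ∏ i, ((a i : ↥(locAtCentre A'.toSubring O)) : K) ^ (μ i))
    (hND4 : ∀ d : ℕ, 4 ≤ d → ∀ (p : ℕ), p.Prime →
    ∀ (k : Type) [Field k] [CharP k p] (K : Type) [Field K] [Algebra k K]
    (O : ValuationSubring K) (A : Subalgebra k K), A.toSubring ≤ O.toSubring → A.FG → IsFractionRing A K →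
    ringKrullDim A ≤ (d : WithBot ℕ∞) → IsRegularLocalRing (locAtCentre A.toSubring O) →
    ringKrullDim (locAtCentre A.toSubring O) = (d : WithBot ℕ∞) →
    (∀ (T : Subring K) (hT : T ≤ O.toSubring), A.toSubring ≤ T → (subringCentre T O hT).IsMaximal) →
    ∀ g₀ : K, (∀ c : K, c ^ p ≠ g₀) →
    (∀ f₀ : K, ∃ f₁ : K, O.valuation (g₀ - f₁ ^ p) < O.valuation (g₀ - f₀ ^ p)) →
    (∀ hk : ∀ c : k, algebraMap k K c ∈ O, transcendenceDefect k O hk ≠ 0) →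
    ¬ (∃ π : K, π ≠ 0 ∧ (∀ x : K, O.valuation x < 1 → O.valuation x ≤ O.valuation π) ∧
      (∀ x : K, x ≠ 0 → ∃ n : ℕ, O.valuation π ^ n ≤ O.valuation x)) →
    ∃ (A' : Subalgebra k K), A'.toSubring ≤ O.toSubring ∧ A ≤ A' ∧ A'.FG ∧
    ∃ (_ : IsRegularLocalRing (locAtCentre A'.toSubring O)) (c : Fin p → K), (∃ j : Fin p, (j : ℕ) ≠ 0 ∧ c j ≠ 0) ∧
    ((∃ (d m : ℕ) (hmd : m ≤ d) (t : Fin d → ↥(locAtCentre A'.toSubring O)) (a : Fin m → ℕ) (u : ↥(locAtCentre A'.toSubring O)), IsUnit u ∧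
    Ideal.span (Set.range t) = IsLocalRing.maximalIdeal ↥(locAtCentre A'.toSubring O) ∧
    ringKrullDim ↥(locAtCentre A'.toSubring O) = (d : WithBot ℕ∞) ∧ 0 < m ∧ (∀ i, ¬ p ∣ a i) ∧
    (∑ j : Fin p, c j ^ p * g₀ ^ (j : ℕ)) = (u : K) * ∏ i : Fin m, ((t (Fin.castLE hmd i) : ↥(locAtCentre A'.toSubring O)) : K) ^ (a i)) ∨
    (∃ u : ↥(locAtCentre A'.toSubring O), IsUnit u ∧ (∑ j : Fin p, c j ^ p * g₀ ^ (j : ℕ)) = (u : K) ∧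
    ∀ c' : ↥(locAtCentre A'.toSubring O), u - c' ^ p ∉ IsLocalRing.maximalIdeal ↥(locAtCentre A'.toSubring O)) ∨
    (∃ s c' : ↥(locAtCentre A'.toSubring O), (∑ j : Fin p, c j ^ p * g₀ ^ (j : ℕ)) = (s : K) ∧
    s - c' ^ p ∈ IsLocalRing.maximalIdeal ↥(locAtCentre A'.toSubring O) ∧
    s - c' ^ p ∉ IsLocalRing.maximalIdeal ↥(locAtCentre A'.toSubring O) ^ 2)))
    (hZ4 : ∀ d : ℕ, 4 ≤ d → ∀ (p : ℕ), p.Prime → ∀ (k K : Type) [Field k] [CharP k p] [Field K] [Algebra k K] [Algebra.EssFiniteType k K],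
    Algebra.trdeg k K = d → ∀ (g₀ : K) (M₁ M₂ : ProjModel k K) (U₁ : M₁.X.Opens) (U₂ : M₂.X.Opens),
    (∀ x ∈ U₁, ModelCleanRegAt p g₀ M₁ x) → (∀ x ∈ U₂, ModelCleanRegAt p g₀ M₂ x) →
    ∃ (N : ProjModel k K) (φ₁ : N.Hom M₁) (φ₂ : N.Hom M₂),
    (∀ y : N.X, φ₁.f y ∈ U₁ → ModelCleanRegAt p g₀ N y) ∧ (∀ y : N.X, φ₂.f y ∈ U₂ → ModelCleanRegAt p g₀ N y)) :
    Summit.ResolutionOfSingularities.ResolutionOfSingularities.Theses.RadicialJung.CleanModels :=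
  cleanModels_of_dimThreeInputs_of_allDimGEFour h11 h112 hBS2 hB h44c
    (fun d hd => cleanLUZeroDim_dim_of_localMonomialization d (hMono4 d hd) (hND4 d hd)) hZ4

end Inputs

end Summit.ResolutionOfSingularities.ResolutionOfSingularities.Theorems.RadicialJung.CleanModels.GradedAssembly

end
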